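import Literature.Probability.RandomPlanarGeometry.SLETransience
import Literature.Probability.RandomPlanarGeometry.SLETransienceLocal
import Literature.Probability.RandomPlanarGeometry.SLETransienceSimple
import Literature.Probability.RandomPlanarGeometry.SLEKappaFourAvoidance
import Literature.Probability.RandomPlanarGeometry.LoewnerSlitAccesses
import Literature.Probability.RandomPlanarGeometry.LoewnerReflection
import Literature.Probability.RandomPlanarGeometry.LoewnerAdapted
import Literature.Probability.RandomPlanarGeometry.SLETraceCriterion
import HarnessLib

/-!
# Transience of the SLE trace, `κ ≤ 4`: the step "`0 ∉ cl γ[1, ∞)`" (Rohde–Schramm, Thm. 7.1) — proofs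

Trunk T-STOCH; theorems only (no new definition, no new named fact). We **discharge** the named
fact `Literature.Probability.RandomPlanarGeometry.RohdeSchramm2005_thm71_simpleStep` of
`SLETransience.lean` (`RohdeSchramm2005_thm71_simpleStep_holds`): for `κ ≤ 4`, if SLE_κ is
generated by a curve, then almost surely `0 ∉ cl γ[1, ∞)`. This is the case `κ ∈ [0, 4]` of the
proof of S. Rohde, O. Schramm, *Basic properties of SLE*, Ann. of Math. 161 (2005), Thm. 7.1
(p. 911):

> "In this range, `γ` is a simple path. Then a.s. there are two limit points `x₀, x₁` for
> `g₁(z)` as `z → 0` in `H₁`. Note that `g₁(γ[1, ∞))` has the same distribution as `γ[0, ∞)`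
> translated by `ξ(1)`. Consequently, Lemma 7.2 shows that a.s. `x₀` and `x₁` are not in the
> closure of `g₁(γ[1, ∞))`. This means that `0 ∉ cl γ[1, ∞)` a.s."

* `κ = 0` (`ae_zero_notMem_closure_sleTrace_image_Ici_zero`): the driving function is `0` and
  the trace is the ray `t ↦ i√(4t)` (`sleTrace_zero_apply_of_isGeneratedByCurve`, from the
  explicit backward flow `Loewner.invFunOn_map_zero_driving`), of modulus `≥ 2` on `[1, ∞)`.
* `0 < κ < 4`: in the tree, `ae_zero_notMem_closure_sleTrace_image_Ici_of_hasSLETrace_of_lt_four`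
  (`SLETransienceLocal`; Koebe route to the simultaneous form of Lemma 7.2).
* `κ = 4` (`ae_zero_notMem_closure_sleTrace_image_Ici_four`), along the printed route, from the
  tree's ingredients: the trace is simple (`ae_isSimpleTrace_sleTrace_of_hasSLETrace`, Thm. 6.1);
  **two accesses** — the real zeros of the boundary extension `f̄₁` of `g₁⁻¹` are exactly
  `x₀(1), x₁(1)` (`Loewner.bdryInv_ofReal_eq_zero_iff`, `LoewnerSlitAccesses`); the **Markov
  property** — the trace `γ¹` of the increments of `W = 2B` after time `1` exists, has the law of
  the trace and is independent of `(B_u)_{u ≤ 1}`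
  (`ae_exists_isGeneratedByCurve_shift_of_hasSLETrace`, `identDistrib_trace_shift`,
  `indepFun_trace_shift`), with `γ(1 + u) = F₁(γ¹(u) + W(1))`
  (`IsGeneratedByCurve.apply_add_eq_extendFrom`); and **Lemma 7.2 at `κ = 4`** per point
  (`ae_ofReal_notMem_closure_range_sleTrace_four`, `SLEKappaFourAvoidance`). What is proved here:
  - `Loewner.IsGeneratedByCurve.exists_bdryInv_eq_zero_of_zero_mem_closure` /
    `…zero_notMem_closure_image_Ici_of_accesses` (deterministic): if `0 ∈ cl γ[s, ∞)` then some
    real zero `w ≠ W(s)` of `f̄ₛ` has `w - W(s) ∈ cl γˢ[0, ∞)`; for a simple curve `w` is one of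
    the two accesses, so it suffices that `γˢ` avoids `x₀(s) - W(s)` and `x₁(s) - W(s)`;
  - `ae_ofReal_notMem_closure_range_of_indepFun` (measure theory): a random path avoiding every
    FIXED nonzero real a.s. avoids an INDEPENDENT a.s.-nonzero random real a.s. (product law and
    Tonelli on a jointly measurable version of the event) — this is how the fixed-point Lemma 7.2
    applies to the random points `xᵢ(1) - W(1)`;
  - `exists_measurable_eq_rightAccess` / `…leftAccess`: `σ(B_u, u ≤ t)`-measurable versions of
    the accesses (limits of the real flow at `±1/(n+1)`, measurable by
    `Loewner.measurable_realFlowTrunc`; the left one through the reflection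
    `Loewner.map_imagAxisRefl`), so that independence from `γ¹` follows from `indepFun_trace_shift`.

## References

* S. Rohde, O. Schramm, *Basic properties of SLE*, Ann. of Math. 161 (2005) 883–924
  (arXiv:math/0106036): Thm. 6.1, Lemma 7.2, Thm. 7.1 and its proof (pp. 909–911), Prop. 2.1.
* G. F. Lawler, *Conformally Invariant Processes in the Plane*, AMS (2005), §4.1, §6.2, Ex. 4.11.
-/

noncomputable section

open Set Filter Topology MeasureTheory ProbabilityTheory Complex Metric
open UpperHalfPlane (upperHalfPlaneSet isOpen_upperHalfPlaneSet)
open scoped NNReal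

namespace Literature.Probability.RandomPlanarGeometry

/-! ### The deterministic step: accesses of `0` in the closure of the shifted trace -/

namespace Loewner

variable {W : ℝ≥0 → ℝ} {γ γs : ℝ≥0 → ℂ}

/-- **A real zero of `f̄ₛ`, other than `Wₛ`, in the closure of the shifted trace.** Let the chain
of the continuous `W` be generated by `γ` with `γ(s) ≠ 0` and the chain of `W(s + ·) - W(s)` by
`γˢ`. If `0 ∈ cl γ[s, ∞)`, then there is a real `w` with `f̄ₛ(w) = 0`, `w ≠ W(s)` and
`w - W(s) ∈ cl γˢ[0, ∞)`: if `γ(s + uₙ) = Fₛ(γˢ(uₙ) + W s) → 0`, perturb the bounded points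
`γˢ(uₙ) + W s` into `ℍₒ`, extract a limit `w` with `Fₛ w = 0`; `w` is real (`Fₛ(ℍₒ) ⊆ ℍₒ`) and
`w ≠ W s` (`Fₛ(W s) = γ s ≠ 0`). (The argument of
`IsGeneratedByCurve.zero_notMem_closure_image_Ici_of_shift`, recorded with its full conclusion.)
[cite: RohdeSchramm2005, proof of Thm 7.1 (p. 911)] -/
theorem IsGeneratedByCurve.exists_bdryInv_eq_zero_of_zero_mem_closure (hγ : IsGeneratedByCurve W γ)
    (hW : Continuous W) {s : ℝ≥0} (hs0 : γ s ≠ 0)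
    (hγs : IsGeneratedByCurve (fun u ↦ W (s + u) - W s) γs)
    (h0 : (0 : ℂ) ∈ closure (γ '' Ici s)) :
    ∃ w : ℝ, bdryInv W s w = 0 ∧ w ≠ W s ∧ ((w - W s : ℝ) : ℂ) ∈ closure (range γs) := by
  set F : ℂ → ℂ := bdryInv W s with hF
  have hFc : ContinuousOn F {z : ℂ | 0 ≤ z.im} := hγ.continuousOn_bdryInv hW s
  obtain ⟨C, hC⟩ := exists_norm_bdryInv_sub_self_le hW s
  -- a sequence `γ (s + u n) → 0`
  obtain ⟨z, hzmem, hzlim⟩ := mem_closure_iff_seq_limit.1 h0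
  have hu : ∀ n, ∃ u : ℝ≥0, z n = F (γs u + W s) := by
    intro n
    obtain ⟨t, ht, hzt⟩ := hzmem n
    refine ⟨t - s, ?_⟩
    have h := hγ.apply_add_eq_extendFrom hW hγs (t - s)
    rw [add_tsub_cancel_of_le (mem_Ici.1 ht)] at h
    rw [← hzt]
    exact h
  choose u hu using hu
  set w : ℕ → ℂ := fun n ↦ γs (u n) + W s with hw
  have hwim : ∀ n, 0 ≤ (w n).im := fun n ↦ by
    simp only [hw, Complex.add_im, Complex.ofReal_im, add_zero]
    exact hγs.im_nonneg (u n)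
  -- perturb into the open half-plane keeping `F` within `1/(n+1)`
  have hpert : ∀ n : ℕ, ∃ ε : ℝ, 0 < ε ∧ ε ≤ 1 / ((n : ℝ) + 1) ∧
      ‖F (w n + I * ε) - F (w n)‖ < 1 / ((n : ℝ) + 1) := by
    intro n
    have hn : (0 : ℝ) < 1 / ((n : ℝ) + 1) := by positivity
    have hcw : ContinuousWithinAt F {z : ℂ | 0 ≤ z.im} (w n) := hFc _ (hwim n)
    have ht : Tendsto (fun ε : ℝ ↦ w n + I * ε) (𝓝[>] 0) (𝓝[{z : ℂ | 0 ≤ z.im}] (w n)) := by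
      refine tendsto_nhdsWithin_of_tendsto_nhds_of_eventually_within _ ?_ ?_
      · have : Tendsto (fun ε : ℝ ↦ w n + I * ε) (𝓝 0) (𝓝 (w n + I * (0 : ℝ))) :=
          ((continuous_const.add (continuous_const.mul Complex.continuous_ofReal)).tendsto 0)
        rw [Complex.ofReal_zero, mul_zero, add_zero] at this
        exact this.mono_left nhdsWithin_le_nhds
      · filter_upwards [self_mem_nhdsWithin] with ε (hε : 0 < ε)
        simp only [Complex.add_im, Complex.mul_im, Complex.I_re, Complex.I_im,
          Complex.ofReal_re, Complex.ofReal_im, zero_mul, one_mul, zero_add]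
        linarith [hwim n]
    have hlim : Tendsto (fun ε : ℝ ↦ F (w n + I * ε)) (𝓝[>] 0) (𝓝 (F (w n))) := hcw.tendsto.comp ht
    have hev : ∀ᶠ ε : ℝ in 𝓝[>] 0, ‖F (w n + I * ε) - F (w n)‖ < 1 / ((n : ℝ) + 1) :=
      (tendsto_iff_norm_sub_tendsto_zero.1 hlim).eventually (gt_mem_nhds hn)
    have hev2 : ∀ᶠ ε : ℝ in 𝓝[>] 0, ε ≤ 1 / ((n : ℝ) + 1) :=
      mem_nhdsWithin_of_mem_nhds (Iic_mem_nhds hn)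
    obtain ⟨ε, ⟨h1, h2⟩, h3⟩ := ((hev.and hev2).and self_mem_nhdsWithin).exists
    exact ⟨ε, h3, h2, h1⟩
  choose ε hεpos hεle hεF using hpert
  set w' : ℕ → ℂ := fun n ↦ w n + I * (ε n) with hw'
  have hw'H : ∀ n, w' n ∈ upperHalfPlaneSet := fun n ↦ by
    show 0 < (w n + I * (ε n)).im
    simp only [Complex.add_im, Complex.mul_im, Complex.I_re, Complex.I_im, Complex.ofReal_re,
      Complex.ofReal_im, zero_mul, one_mul]
    linarith [hwim n, hεpos n]
  -- `F (w' n) → 0`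
  have hinv : Tendsto (fun n : ℕ ↦ (1 : ℝ) / (n + 1)) atTop (𝓝 0) := tendsto_one_div_add_atTop_nhds_zero_nat
  have hFw' : Tendsto (fun n ↦ F (w' n)) atTop (𝓝 0) := by
    have h1 : Tendsto (fun n ↦ F (w n)) atTop (𝓝 0) := by
      refine hzlim.congr fun n ↦ ?_
      rw [hu n]
    have h2 : Tendsto (fun n ↦ F (w' n) - F (w n)) atTop (𝓝 0) :=
      squeeze_zero_norm (fun n ↦ (hεF n).le) hinv
    have := h2.add h1
    simpa using this
  -- the perturbed points are eventually bounded
  have hbdd : ∀ᶠ n in atTop, w' n ∈ closedBall (0 : ℂ) (C + 1) := by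
    have hev : ∀ᶠ n in atTop, ‖F (w' n)‖ < 1 := by
      have := (tendsto_iff_norm_sub_tendsto_zero.1 hFw').eventually (gt_mem_nhds one_pos)
      simpa using this
    filter_upwards [hev] with n hn
    rw [mem_closedBall, dist_zero_right]
    have h1 : ‖F (w' n) - w' n‖ ≤ C := hC _ (hw'H n)
    calc ‖w' n‖ = ‖F (w' n) - (F (w' n) - w' n)‖ := by rw [sub_sub_cancel]
      _ ≤ ‖F (w' n)‖ + ‖F (w' n) - w' n‖ := norm_sub_le _ _
      _ ≤ C + 1 := by linarith
  -- extract a convergent subsequence `w' (φ n) → wlim`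
  obtain ⟨wlim, -, φ, hφ, hconv⟩ := tendsto_subseq_of_frequently_bounded isBounded_closedBall
    hbdd.frequently
  have hwlim_im : 0 ≤ wlim.im :=
    (isClosed_le continuous_const Complex.continuous_im).mem_of_tendsto hconv
      (Eventually.of_forall fun n ↦ show 0 ≤ (w' (φ n)).im from (hw'H (φ n)).le)
  -- `F wlim = 0`
  have hFlim : F wlim = 0 := by
    have h1 : Tendsto (fun n ↦ F (w' (φ n))) atTop (𝓝 (F wlim)) := by
      refine (hFc wlim hwlim_im).tendsto.comp ?_
      exact tendsto_nhdsWithin_iff.2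
        ⟨hconv, Eventually.of_forall fun n ↦ show 0 ≤ (w' (φ n)).im from (hw'H (φ n)).le⟩
    have h2 : Tendsto (fun n ↦ F (w' (φ n))) atTop (𝓝 0) := hFw'.comp hφ.tendsto_atTop
    exact tendsto_nhds_unique h1 h2
  -- `wlim` is real
  have hreal : wlim.im = 0 := by
    refine le_antisymm (not_lt.1 fun hpos ↦ ?_) hwlim_im
    have hmem : F wlim ∈ domain W s := bdryInv_mem_domain hW s hpos
    have : (0 : ℝ) < (F wlim).im := hmem.1
    rw [hFlim, Complex.zero_im] at this
    exact lt_irrefl _ this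
  have hwlim_eq : wlim = ((wlim.re : ℝ) : ℂ) := Complex.ext (by simp) (by simp [hreal])
  -- and differs from `W s`
  have hne : wlim.re ≠ W s := by
    intro heq
    have h1 : F (W s) = γ s := hγ.bdryInv_driving hW s
    rw [← heq, ← hwlim_eq, hFlim] at h1
    exact hs0 h1.symm
  -- `wlim - W s` is a real point of `cl γˢ[0, ∞)`
  have hε0 : Tendsto (fun n ↦ ε (φ n)) atTop (𝓝 0) := by
    have h1 : Tendsto (fun n ↦ ε n) atTop (𝓝 0) :=
      squeeze_zero (fun n ↦ (hεpos n).le) hεle tendsto_one_div_add_atTop_nhds_zero_nat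
    exact h1.comp hφ.tendsto_atTop
  have hwconv : Tendsto (fun n ↦ w (φ n)) atTop (𝓝 wlim) := by
    have h1 : ∀ n, w (φ n) = w' (φ n) - I * (ε (φ n)) := fun n ↦ by
      simp only [hw']; ring
    simp_rw [h1]
    have h2 : Tendsto (fun n ↦ I * ((ε (φ n) : ℝ) : ℂ)) atTop (𝓝 (I * ((0 : ℝ) : ℂ))) :=
      (Complex.continuous_ofReal.tendsto 0 |>.comp hε0).const_mul I
    rw [Complex.ofReal_zero, mul_zero] at h2
    simpa using hconv.sub h2
  have hγsconv : Tendsto (fun n ↦ γs (u (φ n))) atTop (𝓝 (((wlim.re - W s : ℝ) : ℂ))) := by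
    have h1 : ∀ n, γs (u (φ n)) = w (φ n) - (W s : ℂ) := fun n ↦ by simp only [hw]; ring
    simp_rw [h1]
    have h2 := hwconv.sub_const (W s : ℂ)
    rw [hwlim_eq] at h2
    convert h2 using 2
    push_cast
    ring
  have hmem : (((wlim.re - W s : ℝ)) : ℂ) ∈ closure (range γs) :=
    mem_closure_of_tendsto hγsconv (Eventually.of_forall fun n ↦ mem_range_self _)
  refine ⟨wlim.re, ?_, hne, hmem⟩
  rw [← hwlim_eq]
  exact hFlim

/-- **`0 ∉ cl γ[s, ∞)` once the shifted trace avoids the two accesses of `0`** (Rohde–Schramm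
(2005), proof of Thm. 7.1, case `κ ≤ 4`, p. 911: "a.s. `x₀` and `x₁` are not in the closure of
`g₁(γ[1, ∞))`. This means that `0 ∉ cl γ[1, ∞)`"). For the chain of a continuous `W`, `W 0 = 0`,
generated by a simple curve `γ`, `s > 0`, and the chain of `W(s + ·) - W(s)` generated by `γˢ`:
if `x₀(s) - W(s)` and `x₁(s) - W(s)` are not in `cl γˢ[0, ∞)`, then `0 ∉ cl γ[s, ∞)` — a real
zero `w ≠ W(s)` of `f̄ₛ` with `w - W(s) ∈ cl γˢ[0, ∞)`
(`exists_bdryInv_eq_zero_of_zero_mem_closure`) is one of the two accesses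
(`bdryInv_ofReal_eq_zero_iff`). [cite: RohdeSchramm2005, proof of Thm 7.1 (p. 911)] -/
theorem IsGeneratedByCurve.zero_notMem_closure_image_Ici_of_accesses (hγ : IsGeneratedByCurve W γ)
    (hW : Continuous W) (hW0 : W 0 = 0) (hsim : IsSimpleTrace γ) {s : ℝ≥0} (hs : 0 < s)
    (hγs : IsGeneratedByCurve (fun u ↦ W (s + u) - W s) γs)
    (h₀ : ((leftAccess W s - W s : ℝ) : ℂ) ∉ closure (range γs))
    (h₁ : ((rightAccess W s - W s : ℝ) : ℂ) ∉ closure (range γs)) :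
    (0 : ℂ) ∉ closure (γ '' Ici s) := by
  intro h0
  have hs0 : γ s ≠ 0 := fun h ↦ by
    have := hsim.2 s hs
    rw [h, Complex.zero_im] at this
    exact lt_irrefl _ this
  obtain ⟨w, hw0, hne, hmem⟩ := hγ.exists_bdryInv_eq_zero_of_zero_mem_closure hW hs0 hγs h0
  rcases (bdryInv_ofReal_eq_zero_iff hW hW0 hγ hsim hs w).1 hw0 with rfl | rfl
  · exact h₀ hmem
  · exact h₁ hmem

end Loewner

/-! ### The case `κ = 0`: the trace is the vertical ray `t ↦ 2i√t` -/

/-- **The SLE₀ trace is `t ↦ i√(4t)`**: the driving function is `0` and the backward flow is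
explicit, `fₜ(iy) = i√(y² + 4t) → i√(4t)` (`Loewner.invFunOn_map_zero_driving`), while the trace
is the boundary limit of `fₜ` at `Wₜ = 0` (`IsGeneratedByCurve.tendsto_invFunOn_map`).
[cite: Lawler2005, Ex. 4.11] -/
theorem sleTrace_zero_apply_of_isGeneratedByCurve {ω : ℝ≥0 → ℝ}
    (hω : ∃ γ, Loewner.IsGeneratedByCurve (sleDriving 0 ω) γ) (t : ℝ≥0) :
    sleTrace 0 ω t = I * Real.sqrt (4 * t) := by
  have hW : sleDriving 0 ω = fun _ ↦ (0 : ℝ) := by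
    funext u; simp [sleDriving_apply]
  have hgen : Loewner.IsGeneratedByCurve (sleDriving 0 ω) (sleTrace 0 ω) :=
    Loewner.isGeneratedByCurve_trace hω
  have hlim := hgen.tendsto_invFunOn_map (continuous_sleDriving 0 ω) t
  rw [hW] at hlim
  simp only at hlim
  -- approach `0` vertically
  have hpath : Tendsto (fun y : ℝ ↦ I * (y : ℂ)) (𝓝[>] 0) (𝓝[upperHalfPlaneSet] ((0 : ℝ) : ℂ)) := by
    refine tendsto_nhdsWithin_of_tendsto_nhds_of_eventually_within _ ?_ ?_
    · have : Tendsto (fun y : ℝ ↦ I * (y : ℂ)) (𝓝 0) (𝓝 (I * ((0 : ℝ) : ℂ))) :=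
        (continuous_const.mul continuous_ofReal).tendsto 0
      rw [Complex.ofReal_zero, mul_zero] at this
      rw [Complex.ofReal_zero]
      exact this.mono_left nhdsWithin_le_nhds
    · filter_upwards [self_mem_nhdsWithin] with y (hy : 0 < y)
      simpa using hy
  have h1 := hlim.comp hpath
  have h2 : Tendsto (fun y : ℝ ↦ Function.invFunOn (Loewner.map (fun _ ↦ (0 : ℝ)) t)
      (Loewner.domain (fun _ ↦ (0 : ℝ)) t) (I * (y : ℂ))) (𝓝[>] 0) (𝓝 (I * Real.sqrt (4 * t))) := by
    have hc : Tendsto (fun y : ℝ ↦ I * (Real.sqrt (y ^ 2 + 4 * t) : ℂ)) (𝓝[>] 0)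
        (𝓝 (I * (Real.sqrt (0 ^ 2 + 4 * t) : ℂ))) :=
      ((continuous_const.mul (Complex.continuous_ofReal.comp (Real.continuous_sqrt.comp
        ((continuous_pow 2).add continuous_const)))).tendsto 0).mono_left nhdsWithin_le_nhds
    have h0 : I * (Real.sqrt (0 ^ 2 + 4 * t) : ℂ) = I * Real.sqrt (4 * t) := by simp
    rw [h0] at hc
    refine hc.congr' ?_
    filter_upwards [self_mem_nhdsWithin] with y hy
    exact (Loewner.invFunOn_map_zero_driving t hy).symm
  exact tendsto_nhds_unique h1 h2

/-- **`0 ∉ cl γ[1, ∞)` for SLE₀** (surely): the trace is `t ↦ i√(4t)`, of modulus `≥ 2` on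
`[1, ∞)`. The case `κ = 0` of Rohde–Schramm's argument for `κ ∈ [0, 4]` (p. 911), where
everything is deterministic. [cite: RohdeSchramm2005, proof of Thm 7.1 (p. 911)] -/
theorem ae_zero_notMem_closure_sleTrace_image_Ici_zero (h0 : HasSLETrace 0) :
    ∀ᵐ ω ∂Process.preWienerMeasure, (0 : ℂ) ∉ closure (sleTrace 0 ω '' Ici 1) := by
  filter_upwards [h0] with ω hω
  have hsub : sleTrace 0 ω '' Ici 1 ⊆ {z : ℂ | 2 ≤ ‖z‖} := by
    rintro _ ⟨t, ht, rfl⟩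
    rw [sleTrace_zero_apply_of_isGeneratedByCurve hω t, mem_setOf_eq, norm_mul, Complex.norm_I,
      one_mul, Complex.norm_real, Real.norm_eq_abs, abs_of_nonneg (Real.sqrt_nonneg _)]
    have h4 : (4 : ℝ) ≤ 4 * t := by
      have : (1 : ℝ) ≤ t := by exact_mod_cast mem_Ici.1 ht
      linarith
    calc (2 : ℝ) = Real.sqrt 4 := by
          rw [show (4 : ℝ) = 2 ^ 2 by norm_num, Real.sqrt_sq (by norm_num)]
      _ ≤ Real.sqrt (4 * t) := Real.sqrt_le_sqrt h4
  have hcl : closure (sleTrace 0 ω '' Ici 1) ⊆ {z : ℂ | 2 ≤ ‖z‖} :=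
    closure_minimal hsub (isClosed_le continuous_const continuous_norm)
  intro hmem
  have := hcl hmem
  norm_num at this


/-! ### Avoidance of an independent random real point -/

/-- **A random path avoids an independent random real point that it avoids pointwise.** Let
`Y` be a random path, a.s. continuous, and `A` a random real, a.s. nonzero, independent of `Y`.
If for every fixed real `x ≠ 0`, a.s. `x ∉ cl Y[0, ∞)`, then a.s. `A ∉ cl Y[0, ∞)`: the joint
law is the product law, and by Tonelli the bad event `{(a, p) : a ∈ cl p[0, ∞)}` (in the
jointly measurable form "`p` comes within `1/(k+1)` of `a` at a rational time, for every `k`",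
whose sections are the complements of `ptAvoidSet a`) has measure `∫ P[a ∈ cl Y[0, ∞)] dP_A(a) = 0`.
This is how Rohde–Schramm's Lemma 7.2 (a statement for a FIXED point) is applied to the two
random accesses `x₀ - ξ(1)`, `x₁ - ξ(1)` in the proof of Thm. 7.1 (p. 911), the future trace being
independent of `𝓕₁` (standard measure theory: product law of independent variables, Tonelli). [folklore] -/
theorem ae_ofReal_notMem_closure_range_of_indepFun {Ω : Type*} {mΩ : MeasurableSpace Ω}
    {μ : Measure Ω} [IsFiniteMeasure μ] {Y : Ω → ℝ≥0 → ℂ} {A : Ω → ℝ}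
    (hYm : AEMeasurable Y μ) (hAm : AEMeasurable A μ) (hind : IndepFun A Y μ)
    (hYc : ∀ᵐ ω ∂μ, Continuous (Y ω)) (hA0 : ∀ᵐ ω ∂μ, A ω ≠ 0)
    (havoid : ∀ x : ℝ, x ≠ 0 → ∀ᵐ ω ∂μ, (x : ℂ) ∉ closure (range (Y ω))) :
    ∀ᵐ ω ∂μ, ((A ω : ℝ) : ℂ) ∉ closure (range (Y ω)) := by
  -- the bad event, jointly measurable in the point and the path
  set S : Set (ℝ × (ℝ≥0 → ℂ)) :=
    ⋂ k : ℕ, ⋃ q : ℚ, {p | dist (p.2 (q : ℝ).toNNReal) (p.1 : ℂ) < 1 / ((k : ℝ) + 1)} with hSdef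
  have hS : MeasurableSet S := by
    refine MeasurableSet.iInter fun k ↦ MeasurableSet.iUnion fun q ↦ ?_
    exact measurableSet_lt (((measurable_pi_apply _).comp measurable_snd).dist
      (Complex.measurable_ofReal.comp measurable_fst)) measurable_const
  have hiff : ∀ (a : ℝ) (p : ℝ≥0 → ℂ), (a, p) ∈ S ↔ p ∉ ptAvoidSet (a : ℂ) := fun a p ↦ by
    simp only [hSdef, ptAvoidSet, mem_iInter, mem_iUnion, mem_setOf_eq, not_exists, not_forall,
      not_le]
  have hpair : AEMeasurable (fun ω ↦ (A ω, Y ω)) μ := hAm.prodMk hYm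
  have hprod : μ.map (fun ω ↦ (A ω, Y ω)) = (μ.map A).prod (μ.map Y) :=
    (indepFun_iff_map_prod_eq_prod_map_map hAm hYm).1 hind
  -- sections of the bad event are null for `a ≠ 0`
  have hsec : ∀ a : ℝ, a ≠ 0 → μ.map Y (Prod.mk a ⁻¹' S) = 0 := by
    intro a ha
    rw [Measure.map_apply_of_aemeasurable hYm (measurable_prodMk_left hS)]
    refine measure_eq_zero_iff_ae_notMem.2 ?_
    filter_upwards [hYc, havoid a ha] with ω hc hav hmem
    exact (hiff a (Y ω)).1 hmem ((mem_ptAvoidSet_iff hc _).2 hav)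
  -- hence the bad event is null for the product law
  have hzero : μ.map (fun ω ↦ (A ω, Y ω)) S = 0 := by
    rw [hprod, Measure.prod_apply hS]
    have h0 : μ.map A {0} = 0 := by
      rw [Measure.map_apply_of_aemeasurable hAm (measurableSet_singleton 0)]
      refine measure_eq_zero_iff_ae_notMem.2 ?_
      filter_upwards [hA0] with ω hω
      simpa using hω
    have hae : (fun a ↦ μ.map Y (Prod.mk a ⁻¹' S)) =ᵐ[μ.map A] 0 := by
      refine ae_iff.2 (measure_mono_null (fun a ha ↦ ?_) h0)
      rw [mem_singleton_iff]
      by_contra hne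
      exact ha (by simpa using hsec a hne)
    rw [lintegral_congr_ae hae]
    simp
  have hnull : μ ((fun ω ↦ (A ω, Y ω)) ⁻¹' S) = 0 := by
    rw [← Measure.map_apply_of_aemeasurable hpair hS]
    exact hzero
  filter_upwards [measure_eq_zero_iff_ae_notMem.1 hnull, hYc] with ω hω hc
  have hω' : Y ω ∈ ptAvoidSet ((A ω : ℝ) : ℂ) := not_not.1 ((hiff (A ω) (Y ω)).not.1 hω)
  exact (mem_ptAvoidSet_iff hc _).1 hω'

/-! ### Measurable versions of the two accesses -/

section Accesses

variable (κ : ℝ≥0) (t : ℝ≥0)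

/-- **A `σ(W_u, u ≤ t)`-measurable version of the right access `x₁(t)`.** For any σ-algebra `m`
on the canonical space making the driving function `W = √κ B` measurable at times `≤ t`, there is
an `m`-measurable `A` which, whenever the chain of `W(ω)` is generated by a simple curve, equals
`x₁(t) = lim_{x ↓ 0} gₜ(x)`: take `A = inf_n re gₜ(1/(n+1))`, each term written through the
truncated real flow (`Loewner.measurable_realFlowTrunc`: the flow of a real point is a measurable
functional of the path up to time `t`); on the simple event no real point is swallowed, `re gₜ`
is increasing on `(0, ∞)` and tends to `x₁(t)` (`Loewner.tendsto_map_re_rightAccess`). [folklore] -/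
theorem exists_measurable_eq_rightAccess {m : MeasurableSpace (ℝ≥0 → ℝ)}
    (hmeas : ∀ s, s ≤ t → Measurable[m] fun ω ↦ sleDriving κ ω s) :
    ∃ A : (ℝ≥0 → ℝ) → ℝ, Measurable[m] A ∧ ∀ (ω : ℝ≥0 → ℝ) (γ : ℝ≥0 → ℂ),
      Loewner.IsGeneratedByCurve (sleDriving κ ω) γ → Loewner.IsSimpleTrace γ →
        A ω = Loewner.rightAccess (sleDriving κ ω) t := by
  -- the approximants `re gₜ(1/(n+1))`, in measurable form
  set G : ℕ → (ℝ≥0 → ℝ) → ℝ := fun n ω ↦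
    (if (t : WithTop ℝ≥0) < Loewner.swallowingTime (sleDriving κ ω) (1 / ((n : ℝ) + 1) : ℝ) then
      (Loewner.map (sleDriving κ ω) t (1 / ((n : ℝ) + 1) : ℝ)).re - sleDriving κ ω t else 0) +
    sleDriving κ ω t with hGdef
  have hGm : ∀ n, Measurable[m] (G n) := fun n ↦ by
    have h := Loewner.measurable_realFlowTrunc (mΩ := m) (W := fun ω ↦ sleDriving κ ω)
      (t := t) (fun ω ↦ continuous_sleDriving κ ω) (fun ω ↦ sleDriving_zero κ ω)
      hmeas (x := 1 / ((n : ℝ) + 1)) (by positivity)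
    exact h.add (hmeas t le_rfl)
  refine ⟨fun ω ↦ ⨅ n, G n ω, Measurable.iInf hGm, fun ω γ hγ hsim ↦ ?_⟩
  have hW := continuous_sleDriving κ ω
  have hW0 := sleDriving_zero κ ω
  have hpos : ∀ n : ℕ, (0 : ℝ) < 1 / ((n : ℝ) + 1) := fun n ↦ by positivity
  set a : ℕ → ℝ := fun n ↦ (Loewner.map (sleDriving κ ω) t (1 / ((n : ℝ) + 1) : ℝ)).re with ha
  have hGa : ∀ n, G n ω = a n := fun n ↦ by
    have hT := Loewner.lt_swallowingTime_ofReal_of_isSimpleTrace hW hW0 hγ hsim (hpos n).ne' t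
    simp only [hGdef, ha, if_pos hT]
    ring
  simp only [hGa]
  have hanti : Antitone a := by
    intro k n hkn
    have hle : (1 / ((n : ℝ) + 1) : ℝ) ≤ 1 / ((k : ℝ) + 1) :=
      one_div_le_one_div_of_le (by positivity) (by exact_mod_cast Nat.add_le_add_right hkn 1)
    exact (Loewner.map_ofReal_re_strictMonoOn_pos_of_isSimpleTrace hW hW0 hγ hsim t).monotoneOn
      (hpos n) (hpos k) hle
  have hbdd : BddBelow (range a) := ⟨sleDriving κ ω t, by
    rintro _ ⟨n, rfl⟩
    exact (Loewner.driving_lt_map_ofReal_re_of_isSimpleTrace hW hW0 hγ hsim (hpos n) t).le⟩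
  have h1 : Tendsto a atTop (𝓝 (⨅ n, a n)) := tendsto_atTop_ciInf hanti hbdd
  have h2 : Tendsto a atTop (𝓝 (Loewner.rightAccess (sleDriving κ ω) t)) := by
    have hseq : Tendsto (fun n : ℕ ↦ (1 / ((n : ℝ) + 1) : ℝ)) atTop (𝓝[>] 0) :=
      tendsto_nhdsWithin_iff.2 ⟨tendsto_one_div_add_atTop_nhds_zero_nat,
        Eventually.of_forall fun n ↦ hpos n⟩
    exact (Loewner.tendsto_map_re_rightAccess hW hW0 hγ hsim t).comp hseq
  exact tendsto_nhds_unique h1 h2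

/-- **A `σ(W_u, u ≤ t)`-measurable version of the left access `x₀(t)`**: `sup_n re gₜ(-1/(n+1))`,
the flow of the negative points being read through the reflection `σ(z) = -z̄`
(`Loewner.map_imagAxisRefl`: `g^{-W}_t(σ z) = σ(g^W_t z)`, `Loewner.swallowingTime_imagAxisRefl`)
so that `Loewner.measurable_realFlowTrunc` (stated for positive points) applies to `-W`; on the
simple event `re gₜ` is increasing on `(-∞, 0)` and tends to `x₀(t)` as `x ↑ 0`
(`Loewner.tendsto_map_re_leftAccess`). [folklore] -/
theorem exists_measurable_eq_leftAccess {m : MeasurableSpace (ℝ≥0 → ℝ)}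
    (hmeas : ∀ s, s ≤ t → Measurable[m] fun ω ↦ sleDriving κ ω s) :
    ∃ A : (ℝ≥0 → ℝ) → ℝ, Measurable[m] A ∧ ∀ (ω : ℝ≥0 → ℝ) (γ : ℝ≥0 → ℂ),
      Loewner.IsGeneratedByCurve (sleDriving κ ω) γ → Loewner.IsSimpleTrace γ →
        A ω = Loewner.leftAccess (sleDriving κ ω) t := by
  set G : ℕ → (ℝ≥0 → ℝ) → ℝ := fun n ω ↦
    -((if (t : WithTop ℝ≥0) < Loewner.swallowingTime (fun s ↦ -sleDriving κ ω s) (1 / ((n : ℝ) + 1) : ℝ)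
      then (Loewner.map (fun s ↦ -sleDriving κ ω s) t (1 / ((n : ℝ) + 1) : ℝ)).re - -sleDriving κ ω t
      else 0) + -sleDriving κ ω t) with hGdef
  have hGm : ∀ n, Measurable[m] (G n) := fun n ↦ by
    have h := Loewner.measurable_realFlowTrunc (mΩ := m) (W := fun ω s ↦ -sleDriving κ ω s)
      (t := t) (fun ω ↦ (continuous_sleDriving κ ω).neg) (fun ω ↦ by simp)
      (fun s hs ↦ (hmeas s hs).neg) (x := 1 / ((n : ℝ) + 1)) (by positivity)
    exact (h.add (hmeas t le_rfl).neg).neg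
  refine ⟨fun ω ↦ ⨆ n, G n ω, Measurable.iSup hGm, fun ω γ hγ hsim ↦ ?_⟩
  have hW := continuous_sleDriving κ ω
  have hW0 := sleDriving_zero κ ω
  have hpos : ∀ n : ℕ, (0 : ℝ) < 1 / ((n : ℝ) + 1) := fun n ↦ by positivity
  have hneg : ∀ n : ℕ, (-(1 / ((n : ℝ) + 1)) : ℝ) < 0 := fun n ↦ by linarith [hpos n]
  set a : ℕ → ℝ := fun n ↦ (Loewner.map (sleDriving κ ω) t (-(1 / ((n : ℝ) + 1)) : ℝ)).re with ha
  have hGa : ∀ n, G n ω = a n := fun n ↦ by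
    have hrefl : imagAxisRefl (((-(1 / ((n : ℝ) + 1)) : ℝ) : ℂ)) = (((1 / ((n : ℝ) + 1) : ℝ)) : ℂ) := by
      simp
    have hT := Loewner.lt_swallowingTime_ofReal_of_isSimpleTrace hW hW0 hγ hsim (hneg n).ne t
    have hT' : (t : WithTop ℝ≥0) <
        Loewner.swallowingTime (fun s ↦ -sleDriving κ ω s) (1 / ((n : ℝ) + 1) : ℝ) := by
      rw [← hrefl, Loewner.swallowingTime_imagAxisRefl]
      exact hT
    have hmap : (Loewner.map (fun s ↦ -sleDriving κ ω s) t (1 / ((n : ℝ) + 1) : ℝ)).re =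
        -(Loewner.map (sleDriving κ ω) t (-(1 / ((n : ℝ) + 1)) : ℝ)).re := by
      rw [← hrefl, Loewner.map_imagAxisRefl hW]
      simp
    simp only [hGdef, ha, if_pos hT', hmap]
    ring
  simp only [hGa]
  have hmono : Monotone a := by
    intro k n hkn
    have hle : (1 / ((n : ℝ) + 1) : ℝ) ≤ 1 / ((k : ℝ) + 1) :=
      one_div_le_one_div_of_le (by positivity) (by exact_mod_cast Nat.add_le_add_right hkn 1)
    exact (Loewner.map_ofReal_re_strictMonoOn_neg_of_isSimpleTrace hW hW0 hγ hsim t).monotoneOn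
      (hneg k) (hneg n) (by linarith)
  have hbdd : BddAbove (range a) := ⟨sleDriving κ ω t, by
    rintro _ ⟨n, rfl⟩
    exact (Loewner.map_ofReal_re_lt_driving_of_isSimpleTrace hW hW0 hγ hsim (hneg n) t).le⟩
  have h1 : Tendsto a atTop (𝓝 (⨆ n, a n)) := tendsto_atTop_ciSup hmono hbdd
  have h2 : Tendsto a atTop (𝓝 (Loewner.leftAccess (sleDriving κ ω) t)) := by
    have hseq0 : Tendsto (fun n : ℕ ↦ (-(1 / ((n : ℝ) + 1)) : ℝ)) atTop (𝓝 0) := by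
      have h := (tendsto_one_div_add_atTop_nhds_zero_nat (𝕜 := ℝ)).neg
      rw [neg_zero] at h
      exact h
    have hseq : Tendsto (fun n : ℕ ↦ (-(1 / ((n : ℝ) + 1)) : ℝ)) atTop (𝓝[<] 0) :=
      tendsto_nhdsWithin_iff.2 ⟨hseq0, Eventually.of_forall fun n ↦ hneg n⟩
    exact (Loewner.tendsto_map_re_leftAccess hW hW0 hγ hsim t).comp hseq
  exact tendsto_nhds_unique h1 h2

end Accesses

/-! ### The case `κ = 4` -/

/-- **Lemma 7.2 at `κ = 4` for the shifted trace**: for `x ≠ 0`, a.s. `x` is not in the closure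
of the range of the trace of `u ↦ W(s + u) - W(s)`, `W = 2B` — transported from
`ae_ofReal_notMem_closure_range_sleTrace_four` along the identity in law
`identDistrib_trace_shift` through the measurable event `ptAvoidSet`. [cite: RohdeSchramm2005, Lemma 7.2] -/
theorem ae_ofReal_notMem_closure_range_shiftTrace_four (h0 : HasSLETrace 4) (s : ℝ≥0) {x : ℝ}
    (hx : x ≠ 0) :
    ∀ᵐ ω ∂Process.preWienerMeasure, (x : ℂ) ∉
      closure (range (Loewner.trace (fun u ↦ sleDriving 4 ω (s + u) - sleDriving 4 ω s))) := by
  have hs := ae_exists_isGeneratedByCurve_shift_of_hasSLETrace h0 s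
  have hlaw := identDistrib_trace_shift h0 hs
  have h1 : ∀ᵐ ω ∂Process.preWienerMeasure, sleTrace 4 ω ∈ ptAvoidSet (x : ℂ) := by
    filter_upwards [h0, ae_ofReal_notMem_closure_range_sleTrace_four h0 hx] with ω hω h
    exact (mem_ptAvoidSet_iff (Loewner.isGeneratedByCurve_trace hω).continuous _).2 h
  have h2 : Process.preWienerMeasure
      ((fun ω ↦ Loewner.trace (fun u ↦ sleDriving 4 ω (s + u) - sleDriving 4 ω s)) ⁻¹'
        (ptAvoidSet (x : ℂ))ᶜ) = 0 := by
    rw [hlaw.measure_mem_eq (measurableSet_ptAvoidSet _).compl]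
    refine measure_eq_zero_iff_ae_notMem.2 ?_
    filter_upwards [h1] with ω hω
    simpa using hω
  filter_upwards [measure_eq_zero_iff_ae_notMem.1 h2, hs] with ω hω hωs
  simp only [mem_preimage, mem_compl_iff, not_not] at hω
  exact (mem_ptAvoidSet_iff (Loewner.isGeneratedByCurve_trace hωs).continuous _).1 hω

/-- **`0 ∉ cl γ[1, ∞)` a.s. for SLE₄** — the case `κ = 4` of Rohde–Schramm's argument for
`κ ∈ [0, 4]` (proof of Thm. 7.1, p. 911), along the printed route: the trace is simple
(`ae_isSimpleTrace_sleTrace_of_hasSLETrace`, Thm. 6.1); `0` has exactly the two accesses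
`x₀(1), x₁(1)` in `H₁` (`Loewner.bdryInv_ofReal_eq_zero_iff`); the trace `γ¹` of the increments of
the driving function after time `1` exists, has the law of the trace and is independent of `𝓕₁`
(`ae_exists_isGeneratedByCurve_shift_of_hasSLETrace`, `identDistrib_trace_shift`,
`indepFun_trace_shift`), with `γ(1 + u) = F₁(γ¹(u) + W(1))`; Lemma 7.2 at `κ = 4`
(`ae_ofReal_notMem_closure_range_sleTrace_four`) applied to the `𝓕₁`-measurable random points
`x₀(1) - W(1)`, `x₁(1) - W(1)` (`ae_ofReal_notMem_closure_range_of_indepFun`) shows that a.s.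
neither lies in `cl γ¹[0, ∞)`, whence `0 ∉ cl γ[1, ∞)`
(`Loewner.IsGeneratedByCurve.zero_notMem_closure_image_Ici_of_accesses`).
[cite: RohdeSchramm2005, proof of Thm 7.1 (p. 911)] -/
theorem ae_zero_notMem_closure_sleTrace_image_Ici_four (h0 : HasSLETrace 4) :
    ∀ᵐ ω ∂Process.preWienerMeasure, (0 : ℂ) ∉ closure (sleTrace 4 ω '' Ici 1) := by
  haveI : IsProbabilityMeasure Process.preWienerMeasure := isProbabilityMeasure_preWienerMeasure'
  set Y : (ℝ≥0 → ℝ) → ℝ≥0 → ℂ :=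
    fun ω ↦ Loewner.trace (fun u ↦ sleDriving 4 ω (1 + u) - sleDriving 4 ω 1) with hYdef
  have hs := ae_exists_isGeneratedByCurve_shift_of_hasSLETrace h0 1
  have hlaw := identDistrib_trace_shift h0 hs
  have hYm : AEMeasurable Y Process.preWienerMeasure := hlaw.aemeasurable_fst
  have hYc : ∀ᵐ ω ∂Process.preWienerMeasure, Continuous (Y ω) := by
    filter_upwards [hs] with ω hω using (Loewner.isGeneratedByCurve_trace hω).continuous
  have havoid : ∀ x : ℝ, x ≠ 0 → ∀ᵐ ω ∂Process.preWienerMeasure, (x : ℂ) ∉ closure (range (Y ω)) :=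
    fun x hx ↦ ae_ofReal_notMem_closure_range_shiftTrace_four h0 1 hx
  have hgen := ae_isGeneratedByCurve_sleTrace h0
  have hsimple := ae_isSimpleTrace_sleTrace_of_hasSLETrace h0 le_rfl
  -- the past `σ(B_u, u ≤ 1)` and the independence of `Y` from it
  set R : (ℝ≥0 → ℝ) → Iic (1 : ℝ≥0) → ℝ := fun ω u ↦ Process.brownian u ω with hRdef
  have hind : IndepFun Y R Process.preWienerMeasure := indepFun_trace_shift hs
  -- (the sub-σ-algebra `σ(B_u, u ≤ 1) = MeasurableSpace.comap R _` is spelled out: a local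
  -- constant of class type would become an instance)
  have hRm : Measurable R := measurable_pi_lambda _ fun _ ↦ Process.measurable_brownian _
  have hmle : MeasurableSpace.comap R inferInstance ≤ (inferInstance : MeasurableSpace (ℝ≥0 → ℝ)) :=
    hRm.comap_le
  have hmeas : ∀ s, s ≤ (1 : ℝ≥0) →
      Measurable[MeasurableSpace.comap R inferInstance] fun ω ↦ sleDriving 4 ω s := by
    intro s hs1
    have h1 : Measurable[MeasurableSpace.comap R inferInstance] R := comap_measurable R
    have h2 : Measurable[MeasurableSpace.comap R inferInstance] fun ω ↦ R ω ⟨s, hs1⟩ :=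
      (measurable_pi_apply _).comp h1
    exact h2.const_mul _
  have hindep : ∀ {A : (ℝ≥0 → ℝ) → ℝ}, Measurable[MeasurableSpace.comap R inferInstance] A →
      IndepFun A Y Process.preWienerMeasure := by
    intro A hA
    have h := (IndepFun_iff_Indep _ _ _).1 hind
    exact ((IndepFun_iff_Indep _ _ _).2 (indep_of_indep_of_le_right h hA.comap_le)).symm
  -- the two random points, in `σ(B_u, u ≤ 1)`-measurable form
  obtain ⟨X₀, hX₀m, hX₀⟩ := exists_measurable_eq_leftAccess 4 1 hmeas
  obtain ⟨X₁, hX₁m, hX₁⟩ := exists_measurable_eq_rightAccess 4 1 hmeas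
  set A₀ : (ℝ≥0 → ℝ) → ℝ := fun ω ↦ X₀ ω - sleDriving 4 ω 1 with hA₀
  set A₁ : (ℝ≥0 → ℝ) → ℝ := fun ω ↦ X₁ ω - sleDriving 4 ω 1 with hA₁
  have hA₀m : Measurable[MeasurableSpace.comap R inferInstance] A₀ := hX₀m.sub (hmeas 1 le_rfl)
  have hA₁m : Measurable[MeasurableSpace.comap R inferInstance] A₁ := hX₁m.sub (hmeas 1 le_rfl)
  have hA₀m' : AEMeasurable A₀ Process.preWienerMeasure := (hA₀m.mono hmle le_rfl).aemeasurable
  have hA₁m' : AEMeasurable A₁ Process.preWienerMeasure := (hA₁m.mono hmle le_rfl).aemeasurable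
  have hA₀eq : ∀ᵐ ω ∂Process.preWienerMeasure,
      A₀ ω = Loewner.leftAccess (sleDriving 4 ω) 1 - sleDriving 4 ω 1 := by
    filter_upwards [hgen, hsimple] with ω hγ hsim
    simp only [hA₀, hX₀ ω _ hγ hsim]
  have hA₁eq : ∀ᵐ ω ∂Process.preWienerMeasure,
      A₁ ω = Loewner.rightAccess (sleDriving 4 ω) 1 - sleDriving 4 ω 1 := by
    filter_upwards [hgen, hsimple] with ω hγ hsim
    simp only [hA₁, hX₁ ω _ hγ hsim]
  have hA₀0 : ∀ᵐ ω ∂Process.preWienerMeasure, A₀ ω ≠ 0 := by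
    filter_upwards [hA₀eq, hgen, hsimple] with ω heq hγ hsim
    rw [heq]
    exact (sub_neg.2 (Loewner.leftAccess_lt_driving (continuous_sleDriving 4 ω)
      (sleDriving_zero 4 ω) hγ hsim one_pos)).ne
  have hA₁0 : ∀ᵐ ω ∂Process.preWienerMeasure, A₁ ω ≠ 0 := by
    filter_upwards [hA₁eq, hgen, hsimple] with ω heq hγ hsim
    rw [heq]
    exact (sub_pos.2 (Loewner.driving_lt_rightAccess (continuous_sleDriving 4 ω)
      (sleDriving_zero 4 ω) hγ hsim one_pos)).ne'
  -- Lemma 7.2 at the random points, by independence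
  have hav₀ := ae_ofReal_notMem_closure_range_of_indepFun hYm hA₀m' (hindep hA₀m) hYc hA₀0 havoid
  have hav₁ := ae_ofReal_notMem_closure_range_of_indepFun hYm hA₁m' (hindep hA₁m) hYc hA₁0 havoid
  filter_upwards [hgen, hsimple, hs, hav₀, hav₁, hA₀eq, hA₁eq] with ω hγ hsim hωs h₀ h₁ he₀ he₁
  rw [he₀] at h₀
  rw [he₁] at h₁
  exact hγ.zero_notMem_closure_image_Ici_of_accesses (continuous_sleDriving 4 ω) (sleDriving_zero 4 ω)
    hsim one_pos (Loewner.isGeneratedByCurve_trace hωs) h₀ h₁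

/-! ### The named fact -/

/-- **`RohdeSchramm2005_thm71_simpleStep` holds**: for `κ ≤ 4`, if SLE_κ is generated by a curve,
then almost surely `0 ∉ cl γ[1, ∞)` — Rohde–Schramm (2005), proof of Thm. 7.1, case
`κ ∈ [0, 4]` (p. 911). For `κ = 0` the trace is the ray `t ↦ 2i√t`
(`ae_zero_notMem_closure_sleTrace_image_Ici_zero`); for `0 < κ < 4` this is
`ae_zero_notMem_closure_sleTrace_image_Ici_of_hasSLETrace_of_lt_four` (Koebe route to the
simultaneous form of Lemma 7.2); for `κ = 4` it is `ae_zero_notMem_closure_sleTrace_image_Ici_four`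
(the printed route: two accesses, Markov property and independence, Lemma 7.2 at `κ = 4`).
[cite: RohdeSchramm2005, proof of Thm 7.1 (p. 911)] -/
theorem RohdeSchramm2005_thm71_simpleStep_holds : RohdeSchramm2005_thm71_simpleStep := by
  intro κ hκ h0
  rcases eq_or_ne κ 0 with h | hne
  · subst h
    exact ae_zero_notMem_closure_sleTrace_image_Ici_zero h0
  have hpos : 0 < κ := pos_iff_ne_zero.2 hne
  rcases hκ.lt_or_eq with hlt | h4
  · exact ae_zero_notMem_closure_sleTrace_image_Ici_of_hasSLETrace_of_lt_four hpos hlt h0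
  · subst h4
    exact ae_zero_notMem_closure_sleTrace_image_Ici_four h0

end Literature.Probability.RandomPlanarGeometry

end
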